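import Summits.Langlands.Langlands.Theses.NonParallelVoid
import Summits.Langlands.Langlands.Theorems.NonParallelVoidTensorSquareParallelStubDihedralTypeOfTrace
import Summits.Langlands.Langlands.Theorems.NonParallelVoidTensorSquareParallelStubEnormousResidualPackage
import Summits.Langlands.Langlands.Theorems.NonParallelVoidTensorSquareParallelStubResidualIrreducibility
import Summits.Langlands.Langlands.Theorems.NonParallelVoidTensorSquareParallelStubTensorInductionExists
import Summits.Langlands.Langlands.Theorems.NonParallelVoidTensorSquareParallelStubTraceComplexConjugation
import Summits.Langlands.Langlands.Theorems.NonParallelVoidTensorSquareParallelStubOrdinaryDihedralVoid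
import HarnessLib

/-!
# Route `NonParallelVoid`, crux `TensorSquareParallel` (stmt-Langlands-17009): the RESIDUAL PREDICATES of the
# line `merged` (v2) and the kernel-checked glue `stub_residualGlue`

Route-posited predicates (D-0016 `<Route>Defs`-type file; NOTHING IS ASSERTED — each `def … : Prop` is a
*statement*, consumed only as a hypothesis of the glue theorem) produced by the lead of the checked line
`Cruxes/TensorSquareParallel/Lines/merged.lean` (lead prover-line-stmt-Langlands-17009-0, 2026-08-17) after two waves
in which SIX of the line's nine stubs LANDED (`stub_residualIrreducibility` p168846, `stub_dihedralType_of_trace`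
p167854, `stub_enormousResidualPackage` p168313, `stub_tensorInductionExists` p169281, `stub_traceComplexConjugation`
p169312, `stub_ordinaryDihedralVoid` p169582, with helper `stub_labelExtension` p169377).  What is left of the crux is
EXACTLY: five NAMED FACTS of the tree (`BLGGT2014_thmC_potentialAutomorphy` = [BLGGT] Thm C, vendored p167014;
`CaraianiLeHung2016_thm_1_1`; `AHTW2026.hodgeTateWeights_eq` at the pinned data, p166838;
`LabelledHodgeTateWeightsBaseChangeLabelwise`, p167048; `Qian2022.potentialAutomorphy_ordinary 𝓐` at the pinned data
for one family of local Artin data `𝓐`) and the three predicates below; `stub_residualGlue` proves the crux from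
them by composing the landed stubs — ready to serve as `--glue-by` of a planner's split (the lead files nothing).

* `NearOrdinaryImpliesOrdinaryRegular 𝓐` — the LOCAL LEMMA of the ordinary corner: near-ordinary +
  pinned-crystalline + labelled weights `{a<b}` at a SPLIT `p` ⇒ Qian-ordinary with regular weights relative to
  `𝓐 F v` (sub-object functoriality of `D_cris`, crystalline characters of `Γ_{ℚ_p}`, Bloch–Kato
  `H¹_f(ℚ_p, ψ₁ψ₂⁻¹) = 0` for positive weight).  Not expressible from the clauses (F1)–(F12) of `IsFontaineDatum`;
  FALSE without the split hypothesis (a non-split crystalline extension over a quadratic `F_v` is near-ordinary of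
  no dominant weight).
* `TensorInductionLocalClause F p ρ` — the LOCAL clause of Calegari's tensor induction for THE pinned datum: for
  `ρ` crystalline at the two places over the split `p` with labelled weights `{a<b}`, `{a'<b'}`, `b−a ≠ b'−a'`, every
  `ψ` over `ℚ` whose restriction to `Γ_F` is a conjugate of `ρ ⊗ ρ^θ` is crystalline at `p` with four distinct
  labelled Hodge–Tate numbers, inhabited crystalline extension data and potential diagonalisability (⊗-functoriality
  of `D_cris`/`D_dR`, Fontaine; ⊗-stability of PD, [BLGGT] §1.4; PD of the rank-two factors = item PD2Unram,
  stmt-Langlands-14643).  A pinned-datum clause gap, not a conjecture.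
* `SupersingularDihedralSectorAt F p ρ` — THE OPEN REMAINDER (strategist's sector S): the crux restricted to
  `ρ̄|Γ_{F(ζ_p)}` projectively dihedral (trace form) and `ρ` with NO invariant line at some `v ∣ p`.  No engine in
  print (Taylor–Wiles/BLGGT: `ψ̄` reducible; Qian/Hida/Calegari–Mazur: not ordinary; ACC+ 6.1.1: needs residual
  automorphy in a non-parallel weight; Calegari FM II keeps "not of dihedral type"; no change of weight at defect 1).

Universally closed over `F, p, ρ` (with the crux's `NumberField.IsTotallyComplex F` between `F` and `p`) the last
two ARE, definitionally, the registered stub signatures `stub_tensorInductionLocal`, `stub_supersingularDihedral`;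
the five named facts with `NearOrdinaryImpliesOrdinaryRegular` are the registered `stub_externalInputs`.
References: Calegari2010 §2; BarnetlambEtAl2014 Thm C, §1.4; CaraianiLehung2016 Thm 1.1; Qian2022 Thm 1.4, Def 1.2;
Clozel1990 Lemme 4.9; CalegariMazur2008 Conj. 1.3.
-/

noncomputable section

set_option linter.dupNamespace false  -- `Summit.Langlands.Langlands.…` is the mandated summit-side namespace (D-0022)

open scoped NumberField Kronecker
open IsDedekindDomain Field
open Literature.NumberTheory.GaloisRepresentations Literature.NumberTheory.PAdicHodge
  Literature.NumberTheory.Automorphic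

namespace Summit.Langlands.Langlands.Theorems.TensorSquareParallel

/-- **Near-ordinary is Qian-ordinary at a split prime** (predicate on a family of local Artin data `𝓐`; the local
lemma of the ordinary corner, verbatim the last conjunct of the registered stub `stub_externalInputs`): for an
(imaginary) quadratic `F`, `p` split, `ρ : Γ_F → GL₂(ℚ̄_p)` pinned-crystalline at `v ∣ p` with labelled weights
`{a < b}` and an invariant complete flag, `ρ` is ordinary with regular weights at `v` relative to `𝓐 F v`
(Qian 2023 Def. 1.2).  A STATEMENT (pinned-datum clause gap), not an assertion. [cite: Qian2022, Def. 1.2] -/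
def NearOrdinaryImpliesOrdinaryRegular
    (𝓐 : (∀ (K : Type) [Field K] [NumberField K] (v : HeightOneSpectrum (𝓞 K)), LocalArtinData (v.adicCompletion K))) : Prop :=
  (∀ (F : Type) [Field F] [NumberField F] [Algebra.IsQuadraticExtension ℚ F] (p : ℕ) [Fact p.Prime] (ρ : FramedGaloisRep F (PadicAlgCl p) 2), (∃ v w : HeightOneSpectrum (𝓞 F), v ≠ w ∧ ((p : ℕ) : 𝓞 F) ∈ v.asIdeal ∧ ((p : ℕ) : 𝓞 F) ∈ w.asIdeal) → ∀ (v : HeightOneSpectrum (𝓞 F)) (hv : ((p : ℕ) : 𝓞 F) ∈ v.asIdeal), (fontainePstAdicCompletion v p hv).IsCrystallineFramed (ρ.toLocal v) → (letI := (fontainePstAdicCompletion v p hv).algebra; ∀ τ : v.adicCompletion F →ₐ[ℚ_[p]] PadicAlgCl p, ∃ a b : ℤ, a < b ∧ ρ.labelledHodgeTateWeightsAt v (fontainePstAdicCompletion v p hv).algebra (fontainePstAdicCompletion v p hv).𝔅 τ.toRingHom = {a, b}) → FramedRep.HasInvariantCompleteFlag (ρ.toLocal v) → ρ.IsOrdinaryRegularAt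 v (𝓐 F v))

/-- **The local clause of the tensor induction for the pinned datum** (predicate on `F, p, ρ`; closed over them it is
the registered stub `stub_tensorInductionLocal`): ⊗-functoriality of crystallinity / labelled Hodge–Tate weights /
potential diagonalisability at the split prime, for every `ψ` over `ℚ` restricting on `Γ_F` to a conjugate of
`ρ ⊗ ρ^θ`.  A STATEMENT, not an assertion. [cite: BarnetlambEtAl2014, §1.4] -/
def TensorInductionLocalClause (F : Type) [Field F] [NumberField F] [Algebra.IsQuadraticExtension ℚ F]
    (p : ℕ) [Fact p.Prime] (ρ : FramedGaloisRep F (PadicAlgCl p) 2) : Prop :=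
  (∀ (v : HeightOneSpectrum (𝓞 F)) (hv : ((p : ℕ) : 𝓞 F) ∈ v.asIdeal), (fontainePstAdicCompletion v p hv).IsDeRhamFramed (ρ.toLocal v) ∧ (letI := (fontainePstAdicCompletion v p hv).algebra; ∀ τ : v.adicCompletion F →ₐ[ℚ_[p]] PadicAlgCl p, ∃ a b : ℤ, a < b ∧ ρ.labelledHodgeTateWeightsAt v (fontainePstAdicCompletion v p hv).algebra (fontainePstAdicCompletion v p hv).𝔅 τ.toRingHom = {a, b})) → (11 ≤ p ∧ (∃ v w : HeightOneSpectrum (𝓞 F), v ≠ w ∧ ((p : ℕ) : 𝓞 F) ∈ v.asIdeal ∧ ((p : ℕ) : 𝓞 F) ∈ w.asIdeal) ∧ (∀ (v : HeightOneSpectrum (𝓞 F)) (hv : ((p : ℕ) : 𝓞 F) ∈ v.asIdeal), (fontainePstAdicCompletion v p hv).IsCrystallineFramed (ρ.toLocal v)) ∧ FramedGaloisRep.IsResiduallyAbsIrreducible (ρ.restrictField (CyclotomicField p F))) → (∃ (v : HeightOneSpectrum (𝓞 F)) (hv : ((p : ℕ) : 𝓞 F) ∈ v.asIdeal) (w : HeightOneSpectrum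 (𝓞 F)) (hw : ((p : ℕ) : 𝓞 F) ∈ w.asIdeal), letI := (fontainePstAdicCompletion v p hv).algebra; letI := (fontainePstAdicCompletion w p hw).algebra; ∃ (τ : v.adicCompletion F →ₐ[ℚ_[p]] PadicAlgCl p) (σ : w.adicCompletion F →ₐ[ℚ_[p]] PadicAlgCl p) (a b a' b' : ℤ), ρ.labelledHodgeTateWeightsAt v (fontainePstAdicCompletion v p hv).algebra (fontainePstAdicCompletion v p hv).𝔅 τ.toRingHom = {a, b} ∧ a < b ∧ ρ.labelledHodgeTateWeightsAt w (fontainePstAdicCompletion w p hw).algebra (fontainePstAdicCompletion w p hw).𝔅 σ.toRingHom = {a', b'} ∧ a' < b' ∧ b - a ≠ b' - a') → ∀ ψ : FramedGaloisRep ℚ (PadicAlgCl p) 4, (∃ (τ₀ : absoluteGaloisGroup ℚ) (_ : τ₀ ∉ Set.range (absGaloisRestrict ℚ F)) (e : Fin 2 × Fin 2 ≃ Fin 4) (P : GL (Fin 4) (PadicAlgCl p)), ∀ σ : absoluteGaloisGroup F, (ψ (absGaloisRestrict ℚ F σ)).val = P.val * Matrix.reindex e e ((ρ σ).val ⊗ₖ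 (ρ (absGaloisOuterConj ℚ F τ₀ σ)).val) * P⁻¹.val) → (∀ (v : HeightOneSpectrum (𝓞 ℚ)) (hv : ((p : ℕ) : 𝓞 ℚ) ∈ v.asIdeal), (fontainePstAdicCompletion v p hv).IsCrystallineFramed (ψ.toLocal v) ∧ (letI := (fontainePstAdicCompletion v p hv).algebra; (∀ τ : v.adicCompletion ℚ →ₐ[ℚ_[p]] PadicAlgCl p, (let M := ψ.labelledHodgeTateWeightsAt v (fontainePstAdicCompletion v p hv).algebra (fontainePstAdicCompletion v p hv).𝔅 τ.toRingHom; M.Nodup ∧ Multiset.card M = 4)) ∧ Nonempty (PstCrystallineExtensionData (fontainePstAdicCompletion v p hv)) ∧ ∀ 𝔈 : PstCrystallineExtensionData (fontainePstAdicCompletion v p hv), IsPotentiallyDiagonalizable 𝔈.𝔅 (ψ.toLocal v)))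

/-- **Sector S — the supersingular projectively-dihedral remainder of the crux** (predicate on `F, p, ρ`; closed
over them it is the registered stub `stub_supersingularDihedral`): the hypotheses of `TensorSquareParallel` plus
"`tr ρ̄ = η·tr ρ̄` on `Γ_{F(ζ_p)}` for some `η ≠ 1`" and "no invariant complete flag at some `v ∣ p`" imply the
(void) parallel conclusion.  OPEN; a STATEMENT, not an assertion. [cite: CalegariMazur2008, Conj. 1.3] -/
def SupersingularDihedralSectorAt (F : Type) [Field F] [NumberField F] [Algebra.IsQuadraticExtension ℚ F]
    (p : ℕ) [Fact p.Prime] (ρ : FramedGaloisRep F (PadicAlgCl p) 2) : Prop :=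
  ρ.toGaloisRep.IsIrreducible → (∀ᶠ v : HeightOneSpectrum (𝓞 F) in Filter.cofinite, ρ.IsUnramifiedAt v) → (∀ (v : HeightOneSpectrum (𝓞 F)) (hv : ((p : ℕ) : 𝓞 F) ∈ v.asIdeal), (fontainePstAdicCompletion v p hv).IsDeRhamFramed (ρ.toLocal v) ∧ (letI := (fontainePstAdicCompletion v p hv).algebra; ∀ τ : v.adicCompletion F →ₐ[ℚ_[p]] PadicAlgCl p, ∃ a b : ℤ, a < b ∧ ρ.labelledHodgeTateWeightsAt v (fontainePstAdicCompletion v p hv).algebra (fontainePstAdicCompletion v p hv).𝔅 τ.toRingHom = {a, b})) → (11 ≤ p ∧ (∃ v w : HeightOneSpectrum (𝓞 F), v ≠ w ∧ ((p : ℕ) : 𝓞 F) ∈ v.asIdeal ∧ ((p : ℕ) : 𝓞 F) ∈ w.asIdeal) ∧ (∀ (v : HeightOneSpectrum (𝓞 F)) (hv : ((p : ℕ) : 𝓞 F) ∈ v.asIdeal), (fontainePstAdicCompletion v p hv).IsCrystallineFramed (ρ.toLocal v)) ∧ FramedGaloisRep.IsResiduallyAbsIrreducible (ρ.restrictField (CyclotomicField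 p F))) → ¬ (∀ (v : HeightOneSpectrum (𝓞 F)) (hv : ((p : ℕ) : 𝓞 F) ∈ v.asIdeal) (w : HeightOneSpectrum (𝓞 F)) (hw : ((p : ℕ) : 𝓞 F) ∈ w.asIdeal), letI := (fontainePstAdicCompletion v p hv).algebra; letI := (fontainePstAdicCompletion w p hw).algebra; ∀ (τ : v.adicCompletion F →ₐ[ℚ_[p]] PadicAlgCl p) (σ : w.adicCompletion F →ₐ[ℚ_[p]] PadicAlgCl p) (a b a' b' : ℤ), ρ.labelledHodgeTateWeightsAt v (fontainePstAdicCompletion v p hv).algebra (fontainePstAdicCompletion v p hv).𝔅 τ.toRingHom = {a, b} → a < b → ρ.labelledHodgeTateWeightsAt w (fontainePstAdicCompletion w p hw).algebra (fontainePstAdicCompletion w p hw).𝔅 σ.toRingHom = {a', b'} → a' < b' → Even (b - a + (b' - a'))) → ¬ (∃ τ : absoluteGaloisGroup ℚ, τ ∉ Set.range (absGaloisRestrict ℚ F) ∧ ∃ χ : absoluteGaloisGroup F →* (padicAlgClResidueField p)ˣ, ∀ σ σ' : absoluteGaloisGroup F, absGaloisRestrict ℚ F σ' = τ * absGaloisRestrict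 ℚ F σ * τ⁻¹ → (ρ.residualRep σ').val.trace = (χ σ : padicAlgClResidueField p) * (ρ.residualRep σ).val.trace ∧ (ρ.residualRep σ').val.det = (χ σ : padicAlgClResidueField p) ^ 2 * (ρ.residualRep σ).val.det) → (∃ η : absoluteGaloisGroup (CyclotomicField p F) →* (padicAlgClResidueField p)ˣ, η ≠ 1 ∧ ∀ σ : absoluteGaloisGroup (CyclotomicField p F), (ρ.residualRep (absGaloisRestrict F (CyclotomicField p F) σ)).val.trace = (η σ : padicAlgClResidueField p) * (ρ.residualRep (absGaloisRestrict F (CyclotomicField p F) σ)).val.trace) → ¬ (∀ v : HeightOneSpectrum (𝓞 F), ((p : ℕ) : 𝓞 F) ∈ v.asIdeal → FramedRep.HasInvariantCompleteFlag (ρ.toLocal v)) → ∃ g : ℤ, ∀ (v : HeightOneSpectrum (𝓞 F)) (hv : ((p : ℕ) : 𝓞 F) ∈ v.asIdeal), letI := (fontainePstAdicCompletion v p hv).algebra; ∀ τ : v.adicCompletion F →ₐ[ℚ_[p]] PadicAlgCl p, ∃ a : ℤ, ρ.labelledHodgeTateWeightsAt v (fontainePstAdicCompletion v p hv).algebra (fontainePstAdicCompletion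 v p hv).𝔅 τ.toRingHom = {a, a + g}

/-- **Glue (registered stub `stub_residualGlue`)**: the crux `TensorSquareParallel` follows from the five named facts,
the local lemma, the tensor-induction local clause and sector S — kernel-checked composition of the SIX LANDED stubs
of the line `merged`: off the dihedral locus the tensor induction `ψ` (`stub_tensorInductionExists`), its local clause,
its residual irreducibility on `Γ_{ℚ(ζ_p)}` (`stub_residualIrreducibility`) and [BLGGT] Thm C + Caraiani–Le Hung
(`stub_traceComplexConjugation`) give `tr ψ(c) = 0` against `tr ψ(c) ≠ 0`; on it, with an invariant line everywhere,
dihedral type (`stub_dihedralType_of_trace`), the enormous package (`stub_enormousResidualPackage`) and Qian + purity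
(`stub_ordinaryDihedralVoid`) give `False`; the supersingular dihedral corner is sector S itself.
[cite: Calegari2010, §2] [cite: BarnetlambEtAl2014, Thm. C] [cite: Qian2022, Thm. 1.4] [cite: Clozel1990, Lemme 4.9] -/
theorem stub_residualGlue :
    BLGGT2014_thmC_potentialAutomorphy → CaraianiLeHung2016_thm_1_1 → AHTW2026.hodgeTateWeights_eq (fun (K : Type) (_ : Field K) (_ : NumberField K) (p : ℕ) (_ : Fact p.Prime) (v : HeightOneSpectrum (𝓞 K)) (hv : ((p : ℕ) : 𝓞 K) ∈ v.asIdeal) => fontainePstAdicCompletion v p hv) → LabelledHodgeTateWeightsBaseChangeLabelwise → ∀ 𝓐 : (∀ (K : Type) [Field K] [NumberField K] (v : HeightOneSpectrum (𝓞 K)), LocalArtinData (v.adicCompletion K)), Qian2022.potentialAutomorphy_ordinary 𝓐 (fun (K : Type) (_ : Field K) (_ : NumberField K) (p : ℕ) (_ : Fact p.Prime) (v : HeightOneSpectrum (𝓞 K)) (hv : ((p : ℕ) : 𝓞 K) ∈ v.asIdeal) => fontainePstAdicCompletion v p hv) → NearOrdinaryImpliesOrdinaryRegular 𝓐 → (∀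 (F : Type) [Field F] [NumberField F] [Algebra.IsQuadraticExtension ℚ F], NumberField.IsTotallyComplex F → ∀ (p : ℕ) [Fact p.Prime] (ρ : FramedGaloisRep F (PadicAlgCl p) 2), TensorInductionLocalClause F p ρ) → (∀ (F : Type) [Field F] [NumberField F] [Algebra.IsQuadraticExtension ℚ F], NumberField.IsTotallyComplex F → ∀ (p : ℕ) [Fact p.Prime] (ρ : FramedGaloisRep F (PadicAlgCl p) 2), SupersingularDihedralSectorAt F p ρ) → Summit.Langlands.Langlands.Theses.NonParallelVoid.TensorSquareParallel := by
  intro hC hCLH hAHTW hBC 𝓐 hQ hOrd hTL hSS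
  have HTI := stub_tensorInductionExists
  have HTL : ∀ (F : Type) [Field F] [NumberField F] [Algebra.IsQuadraticExtension ℚ F], NumberField.IsTotallyComplex F → ∀ (p : ℕ) [Fact p.Prime] (ρ : FramedGaloisRep F (PadicAlgCl p) 2), (∀ (v : HeightOneSpectrum (𝓞 F)) (hv : ((p : ℕ) : 𝓞 F) ∈ v.asIdeal), (fontainePstAdicCompletion v p hv).IsDeRhamFramed (ρ.toLocal v) ∧ (letI := (fontainePstAdicCompletion v p hv).algebra; ∀ τ : v.adicCompletion F →ₐ[ℚ_[p]] PadicAlgCl p, ∃ a b : ℤ, a < b ∧ ρ.labelledHodgeTateWeightsAt v (fontainePstAdicCompletion v p hv).algebra (fontainePstAdicCompletion v p hv).𝔅 τ.toRingHom = {a, b})) → (11 ≤ p ∧ (∃ v w : HeightOneSpectrum (𝓞 F), v ≠ w ∧ ((p : ℕ) : 𝓞 F) ∈ v.asIdeal ∧ ((p : ℕ) : 𝓞 F) ∈ w.asIdeal) ∧ (∀ (v : HeightOneSpectrum (𝓞 F)) (hv : ((p : ℕ) : 𝓞 F) ∈ v.asIdeal), (fontainePstAdicCompletion v p hv).IsCrystallineFramed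 (ρ.toLocal v)) ∧ FramedGaloisRep.IsResiduallyAbsIrreducible (ρ.restrictField (CyclotomicField p F))) → (∃ (v : HeightOneSpectrum (𝓞 F)) (hv : ((p : ℕ) : 𝓞 F) ∈ v.asIdeal) (w : HeightOneSpectrum (𝓞 F)) (hw : ((p : ℕ) : 𝓞 F) ∈ w.asIdeal), letI := (fontainePstAdicCompletion v p hv).algebra; letI := (fontainePstAdicCompletion w p hw).algebra; ∃ (τ : v.adicCompletion F →ₐ[ℚ_[p]] PadicAlgCl p) (σ : w.adicCompletion F →ₐ[ℚ_[p]] PadicAlgCl p) (a b a' b' : ℤ), ρ.labelledHodgeTateWeightsAt v (fontainePstAdicCompletion v p hv).algebra (fontainePstAdicCompletion v p hv).𝔅 τ.toRingHom = {a, b} ∧ a < b ∧ ρ.labelledHodgeTateWeightsAt w (fontainePstAdicCompletion w p hw).algebra (fontainePstAdicCompletion w p hw).𝔅 σ.toRingHom = {a', b'} ∧ a' < b' ∧ b - a ≠ b' - a') → ∀ ψ : FramedGaloisRep ℚ (PadicAlgCl p) 4, (∃ (τ₀ : absoluteGaloisGroup ℚ) (_ : τ₀ ∉ Set.range (absGaloisRestrict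 ℚ F)) (e : Fin 2 × Fin 2 ≃ Fin 4) (P : GL (Fin 4) (PadicAlgCl p)), ∀ σ : absoluteGaloisGroup F, (ψ (absGaloisRestrict ℚ F σ)).val = P.val * Matrix.reindex e e ((ρ σ).val ⊗ₖ (ρ (absGaloisOuterConj ℚ F τ₀ σ)).val) * P⁻¹.val) → (∀ (v : HeightOneSpectrum (𝓞 ℚ)) (hv : ((p : ℕ) : 𝓞 ℚ) ∈ v.asIdeal), (fontainePstAdicCompletion v p hv).IsCrystallineFramed (ψ.toLocal v) ∧ (letI := (fontainePstAdicCompletion v p hv).algebra; (∀ τ : v.adicCompletion ℚ →ₐ[ℚ_[p]] PadicAlgCl p, (let M := ψ.labelledHodgeTateWeightsAt v (fontainePstAdicCompletion v p hv).algebra (fontainePstAdicCompletion v p hv).𝔅 τ.toRingHom; M.Nodup ∧ Multiset.card M = 4)) ∧ Nonempty (PstCrystallineExtensionData (fontainePstAdicCompletion v p hv)) ∧ ∀ 𝔈 : PstCrystallineExtensionData (fontainePstAdicCompletion v p hv), IsPotentiallyDiagonalizable 𝔈.𝔅 (ψ.toLocal v))) := hTL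
  have HTZ := stub_traceComplexConjugation
  have HOV := stub_ordinaryDihedralVoid
  have HSS : ∀ (F : Type) [Field F] [NumberField F] [Algebra.IsQuadraticExtension ℚ F], NumberField.IsTotallyComplex F → ∀ (p : ℕ) [Fact p.Prime] (ρ : FramedGaloisRep F (PadicAlgCl p) 2), ρ.toGaloisRep.IsIrreducible → (∀ᶠ v : HeightOneSpectrum (𝓞 F) in Filter.cofinite, ρ.IsUnramifiedAt v) → (∀ (v : HeightOneSpectrum (𝓞 F)) (hv : ((p : ℕ) : 𝓞 F) ∈ v.asIdeal), (fontainePstAdicCompletion v p hv).IsDeRhamFramed (ρ.toLocal v) ∧ (letI := (fontainePstAdicCompletion v p hv).algebra; ∀ τ : v.adicCompletion F →ₐ[ℚ_[p]] PadicAlgCl p, ∃ a b : ℤ, a < b ∧ ρ.labelledHodgeTateWeightsAt v (fontainePstAdicCompletion v p hv).algebra (fontainePstAdicCompletion v p hv).𝔅 τ.toRingHom = {a, b})) → (11 ≤ p ∧ (∃ v w : HeightOneSpectrum (𝓞 F), v ≠ w ∧ ((p : ℕ) : 𝓞 F) ∈ v.asIdeal ∧ ((p : ℕ) : 𝓞 F)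 ∈ w.asIdeal) ∧ (∀ (v : HeightOneSpectrum (𝓞 F)) (hv : ((p : ℕ) : 𝓞 F) ∈ v.asIdeal), (fontainePstAdicCompletion v p hv).IsCrystallineFramed (ρ.toLocal v)) ∧ FramedGaloisRep.IsResiduallyAbsIrreducible (ρ.restrictField (CyclotomicField p F))) → ¬ (∀ (v : HeightOneSpectrum (𝓞 F)) (hv : ((p : ℕ) : 𝓞 F) ∈ v.asIdeal) (w : HeightOneSpectrum (𝓞 F)) (hw : ((p : ℕ) : 𝓞 F) ∈ w.asIdeal), letI := (fontainePstAdicCompletion v p hv).algebra; letI := (fontainePstAdicCompletion w p hw).algebra; ∀ (τ : v.adicCompletion F →ₐ[ℚ_[p]] PadicAlgCl p) (σ : w.adicCompletion F →ₐ[ℚ_[p]] PadicAlgCl p) (a b a' b' : ℤ), ρ.labelledHodgeTateWeightsAt v (fontainePstAdicCompletion v p hv).algebra (fontainePstAdicCompletion v p hv).𝔅 τ.toRingHom = {a, b} → a < b → ρ.labelledHodgeTateWeightsAt w (fontainePstAdicCompletion w p hw).algebra (fontainePstAdicCompletion w p hw).𝔅 σ.toRingHom = {a', b'} → a' < b' →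 Even (b - a + (b' - a'))) → ¬ (∃ τ : absoluteGaloisGroup ℚ, τ ∉ Set.range (absGaloisRestrict ℚ F) ∧ ∃ χ : absoluteGaloisGroup F →* (padicAlgClResidueField p)ˣ, ∀ σ σ' : absoluteGaloisGroup F, absGaloisRestrict ℚ F σ' = τ * absGaloisRestrict ℚ F σ * τ⁻¹ → (ρ.residualRep σ').val.trace = (χ σ : padicAlgClResidueField p) * (ρ.residualRep σ).val.trace ∧ (ρ.residualRep σ').val.det = (χ σ : padicAlgClResidueField p) ^ 2 * (ρ.residualRep σ).val.det) → (∃ η : absoluteGaloisGroup (CyclotomicField p F) →* (padicAlgClResidueField p)ˣ, η ≠ 1 ∧ ∀ σ : absoluteGaloisGroup (CyclotomicField p F), (ρ.residualRep (absGaloisRestrict F (CyclotomicField p F) σ)).val.trace = (η σ : padicAlgClResidueField p) * (ρ.residualRep (absGaloisRestrict F (CyclotomicField p F) σ)).val.trace) → ¬ (∀ v : HeightOneSpectrum (𝓞 F), ((p : ℕ) : 𝓞 F) ∈ v.asIdeal → FramedRep.HasInvariantCompleteFlag (ρ.toLocal v)) → ∃ g : ℤ, ∀ (v : HeightOneSpectrum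 (𝓞 F)) (hv : ((p : ℕ) : 𝓞 F) ∈ v.asIdeal), letI := (fontainePstAdicCompletion v p hv).algebra; ∀ τ : v.adicCompletion F →ₐ[ℚ_[p]] PadicAlgCl p, ∃ a : ℤ, ρ.labelledHodgeTateWeightsAt v (fontainePstAdicCompletion v p hv).algebra (fontainePstAdicCompletion v p hv).𝔅 τ.toRingHom = {a, a + g} := hSS
  replace hOrd : (∀ (F : Type) [Field F] [NumberField F] [Algebra.IsQuadraticExtension ℚ F] (p : ℕ) [Fact p.Prime] (ρ : FramedGaloisRep F (PadicAlgCl p) 2), (∃ v w : HeightOneSpectrum (𝓞 F), v ≠ w ∧ ((p : ℕ) : 𝓞 F) ∈ v.asIdeal ∧ ((p : ℕ) : 𝓞 F) ∈ w.asIdeal) → ∀ (v : HeightOneSpectrum (𝓞 F)) (hv : ((p : ℕ) : 𝓞 F) ∈ v.asIdeal), (fontainePstAdicCompletion v p hv).IsCrystallineFramed (ρ.toLocal v) → (letI := (fontainePstAdicCompletion v p hv).algebra; ∀ τ : v.adicCompletion F →ₐ[ℚ_[p]] PadicAlgCl p, ∃ a b : ℤ, a < b ∧ ρ.labelledHodgeTateWeightsAt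 v (fontainePstAdicCompletion v p hv).algebra (fontainePstAdicCompletion v p hv).𝔅 τ.toRingHom = {a, b}) → FramedRep.HasInvariantCompleteFlag (ρ.toLocal v) → ρ.IsOrdinaryRegularAt v (𝓐 F v)) := hOrd
  clear hTL hSS
  intro F _ _ _ hF p _ ρ hirr hunr hHT hG hE hB
  -- two labels with different gaps, from the failure of the parity clause (used on both attacked branches)
  have hNP : (∃ (v : HeightOneSpectrum (𝓞 F)) (hv : ((p : ℕ) : 𝓞 F) ∈ v.asIdeal) (w : HeightOneSpectrum (𝓞 F)) (hw : ((p : ℕ) : 𝓞 F) ∈ w.asIdeal), letI := (fontainePstAdicCompletion v p hv).algebra; letI := (fontainePstAdicCompletion w p hw).algebra; ∃ (τ : v.adicCompletion F →ₐ[ℚ_[p]] PadicAlgCl p) (σ : w.adicCompletion F →ₐ[ℚ_[p]] PadicAlgCl p) (a b a' b' : ℤ), ρ.labelledHodgeTateWeightsAt v (fontainePstAdicCompletion v p hv).algebra (fontainePstAdicCompletion v p hv).𝔅 τ.toRingHom = {a, b} ∧ a < b ∧ ρ.labelledHodgeTateWeightsAt w (fontainePstAdicCompletion w p hw).algebra (fontainePstAdicCompletion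 w p hw).𝔅 σ.toRingHom = {a', b'} ∧ a' < b' ∧ b - a ≠ b' - a') := by
    by_contra hcon
    apply hE
    intro v hv w hw τ σ a b a' b' h1 h2 h3 h4
    by_contra hodd
    exact hcon ⟨v, hv, w, hw, τ, σ, a, b, a', b', h1, h2, h3, h4, fun heq => hodd ⟨b - a, by rw [← heq]⟩⟩
  by_cases hD : (∃ η : absoluteGaloisGroup (CyclotomicField p F) →* (padicAlgClResidueField p)ˣ, η ≠ 1 ∧ ∀ σ : absoluteGaloisGroup (CyclotomicField p F), (ρ.residualRep (absGaloisRestrict F (CyclotomicField p F) σ)).val.trace = (η σ : padicAlgClResidueField p) * (ρ.residualRep (absGaloisRestrict F (CyclotomicField p F) σ)).val.trace)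
  · by_cases hLR : (∀ v : HeightOneSpectrum (𝓞 F), ((p : ℕ) : 𝓞 F) ∈ v.asIdeal → FramedRep.HasInvariantCompleteFlag (ρ.toLocal v))
    · -- the nearly ordinary dihedral corner: dihedral type ⟹ enormous ⟹ Qian ⟹ purity
      exfalso
      obtain ⟨hdt, hfin, hcop⟩ := stub_dihedralType_of_trace F hF p ρ hG.1 hG.2.2.2 hD
      have hRP := stub_enormousResidualPackage F hF p ρ hG.1 hG.2.1 hG.2.2.2 hdt hfin hcop
      exact HOV 𝓐 hQ hOrd hAHTW hBC F hF p ρ hG.2.1 hunr hHT hG.2.2.1 hLR hRP hNP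
    · exact HSS F hF p ρ hirr hunr hHT hG hE hB hD hLR
  · -- off the corner: the tensor induction line
    exfalso
    obtain ⟨ψ, hT0, hT0', hT1, hT2, hT5⟩ := HTI F hF p ρ hunr
    have hT3 := HTL F hF p ρ hHT hG hNP ψ hT0'
    have hT4 := stub_residualIrreducibility F hF p ρ hirr hunr hHT hG hB hD ψ hT0
    obtain ⟨c, hc⟩ := exists_isComplexConjugation (Rat.castHom ℝ)
    exact hT5 _ c hc (HTZ hC hCLH p hG.1 ψ hT1 hT2 hT3 hT4 _ c hc)


end Summit.Langlands.Langlands.Theorems.TensorSquareParallel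

end
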